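import Summits.CriticalPhenomena.PercolationContinuityZ3.Theorems.PercNearOneGluingNoHeavyLowerTailSahiSlotPairCone
import Summits.CriticalPhenomena.PercolationContinuityZ3.Theorems.PercNearOneGluingNoHeavyLowerTailSahiGridPatternKernel

/-!
# prim-sahi-p1's `226` kernel-checked SLICE CERTIFICATES of `[3]^3` ARE pinned (pivotal-pair) certificates; increments between comparable points;
# axis-permutation transport of certificates

Support file of the one-cut programme (crux `NoHeavyLowerTail`, stmt-CriticalPhenomena-4575; cell `prim-masterthm`, seat P3, gen 23;
`run/shared/lean/prim/prim-masterthm/prim-masterthm-p3/HIERARCHY.md` §31, memo `FROM-prim-masterthm-p3-g23-FORMAT-LIFTS.md`).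

* `InCone.incr_of_le`: `B ↦ 1_B(hi) − 1_B(lo)` is a cone functional for every `lo ≤ hi` (coordinate path of cut edges), every `d`;
  `InPairCone.listSum`.
* `Lit.perm`, `Lit.eval_perm`, `sStarD_perm_eq`, **`PinnedGood.perm`**: pinned certificates transport along axis permutations (p1's `tcD_perm`).
* **`pinnedGood_of_sliceCheck`**: a certificate accepted by prim-sahi-p1's Boolean checker `sliceCheck v L cert` (generation 7: `L·β_{U v} = Σ c·γ⊗γ'`
  entrywise, `γ` point evaluations / upward differences `gcoP`) IS a `PinnedGood 3 (U v)` certificate (`inCone_gcoP`); so the 226 theorems of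
  `…SahiGridPatternSlices1–16` re-run through this lemma give `PinnedGood 3` for the orbit representatives (companion files `…SahiSlotPairConeSlices01–16`),
  and **`pinnedGood_three_of_reps`** (p1's cover `exists_cover` / `coverData_check` + `PinnedGood.perm`) assembles ALL 980 up-sets:
  `pinnedLitCert_three_two_of_reps` — the `(3,3)` row of the pinned format, from the representatives.
HONEST LABEL: format bookkeeping over p1's kernel data; no open cell changes status.  Pure, standard axioms. [this work]
-/

noncomputable section

namespace Summit.CriticalPhenomena.PercolationContinuityZ3.Theorems

open Finset Function
open Literature.Combinatorics.Sahi2008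

namespace SahiSlot

open SahiGridPattern SahiGrid3

/-! ### Increments between comparable points; list sums -/

section General

variable {d : ℕ}

/-- The intermediate points of the coordinate path from `lo` to `hi`: `hi` on the axes `< k`, `lo` elsewhere. [this work] -/
def midPt (lo hi : Q d 3) (k : ℕ) : Q d 3 := fun a => if (a : ℕ) < k then hi a else lo a

/-- Start of the path. [this work] -/
theorem midPt_zero (lo hi : Q d 3) : midPt lo hi 0 = lo := by
  funext a; simp [midPt]

/-- End of the path. [this work] -/
theorem midPt_self (lo hi : Q d 3) : midPt lo hi d = hi := by
  funext a; simp [midPt, a.isLt]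

/-- One more axis switched. [this work] -/
theorem midPt_succ (lo hi : Q d 3) {k : ℕ} (hk : k < d) :
    midPt lo hi (k + 1) = update (midPt lo hi k) ⟨k, hk⟩ (hi ⟨k, hk⟩) := by
  funext a
  by_cases ha : a = ⟨k, hk⟩
  · subst ha; simp [midPt]
  · rw [update_of_ne ha]
    have hne : (a : ℕ) ≠ k := fun h => ha (Fin.ext h)
    unfold midPt
    by_cases h1 : (a : ℕ) < k
    · rw [if_pos h1, if_pos (Nat.lt_succ_of_lt h1)]
    · have h2 : ¬ (a : ℕ) < k + 1 := fun h => hne (by omega)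
      rw [if_neg h1, if_neg h2]

/-- The not-yet-switched axis carries `lo`. [this work] -/
theorem update_midPt_lo (lo hi : Q d 3) {k : ℕ} (hk : k < d) :
    update (midPt lo hi k) ⟨k, hk⟩ (lo ⟨k, hk⟩) = midPt lo hi k := by
  have e : midPt lo hi k ⟨k, hk⟩ = lo ⟨k, hk⟩ := by simp [midPt]
  rw [← e, update_eq_self]

/-- **Increments between comparable points are in the cone**: `B ↦ 1_B(hi) − 1_B(lo)` for `lo ≤ hi` (a coordinate path of cut edges). [this work] -/
theorem InCone.incr_of_le {lo hi : Q d 3} (h : lo ≤ hi) : InCone d (fun B => setInd B hi - setInd B lo) := by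
  have key : ∀ k : ℕ, k ≤ d → InCone d (fun B => setInd B (midPt lo hi k) - setInd B lo) := by
    intro k
    induction k with
    | zero => intro _; exact InCone.zero.congr fun B _ => by rw [midPt_zero]; exact sub_self _
    | succ k ih =>
      intro hk
      have hk' : k < d := hk
      have h1 := ih (le_of_lt hk')
      have h2 := InCone.incr (midPt lo hi k) ⟨k, hk'⟩ (h ⟨k, hk'⟩)
      refine (h1.add h2).congr fun B _ => ?_
      rw [midPt_succ lo hi hk', update_midPt_lo lo hi hk']
      ring
  have := key d le_rfl
  rwa [midPt_self] at this

/-- List-indexed sums of pair-cone functionals. [this work] -/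
theorem InPairCone.listSum {ι : Type*} (l : List ι) {F : ι → Finset (Q d 3) → Finset (Q d 3) → ℝ} (h : ∀ x ∈ l, InPairCone d (F x)) :
    InPairCone d (fun B C => (l.map fun x => F x B C).sum) := by
  induction l with
  | nil => exact InPairCone.zero.congr fun B C _ _ => by simp
  | cons x l ih =>
    have h1 : InPairCone d (F x) := h x (List.mem_cons_self)
    have h2 := ih fun y hy => h y (List.mem_cons_of_mem x hy)
    exact (h1.add h2).congr fun B C _ _ => by simp

/-! ### Axis permutations -/

/-- Transport of a literal along an axis permutation `τ`: `(τ•ℓ)(1_{B'}) = ℓ(1_B)` when `B = {x ∘ τ : x ∈ B'}`. [this work] -/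
def Lit.perm (τ : Equiv.Perm (Fin d)) : Lit d 3 → Lit d 3
  | .bot => .bot
  | .top => .top
  | .cover p a => .cover (p ∘ ⇑τ.symm) (τ a)

/-- The `top` literal on an indicator. [this work] -/
theorem eval_top_setInd (B : Finset (Q d 3)) : (Lit.top : Lit d 3).eval (setInd B) = 1 - setInd B (fun _ => 2) := by
  show (if h : 0 < 3 then 1 - setInd B (fun _ => ⟨3 - 1, Nat.sub_lt h Nat.one_pos⟩) else 0) = _
  rw [dif_pos (by norm_num)]
  rfl

/-- Indicator of the permuted set. [this work] -/
theorem setInd_map_compEquivD (τ : Equiv.Perm (Fin d)) (B' : Finset (Pd d)) (y : Pd d) :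
    setInd (B'.map (compEquivD τ).toEmbedding) y = setInd B' (y ∘ ⇑τ.symm) := by
  simp only [setInd_apply, Finset.mem_map_equiv]
  rfl

/-- The transported literal evaluates as the original on the permuted set. [this work] -/
theorem Lit.eval_perm (τ : Equiv.Perm (Fin d)) (ℓ : Lit d 3) (B' : Finset (Pd d)) :
    (ℓ.perm τ).eval (setInd B') = ℓ.eval (setInd (B'.map (compEquivD τ).toEmbedding)) := by
  cases ℓ with
  | bot =>
    show (Lit.bot : Lit d 3).eval (setInd B') = _
    rw [eval_bot_setInd, eval_bot_setInd, setInd_map_compEquivD]; rfl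
  | top =>
    show (Lit.top : Lit d 3).eval (setInd B') = _
    rw [eval_top_setInd, eval_top_setInd, setInd_map_compEquivD]; rfl
  | cover p a =>
    show (Lit.cover (p ∘ ⇑τ.symm) (τ a) : Lit d 3).eval (setInd B') = (Lit.cover p a : Lit d 3).eval _
    have hpa : ((p ∘ ⇑τ.symm) (τ a) : ℕ) = (p a : ℕ) := by simp
    by_cases h : (p a : ℕ) + 1 < 3
    · have h' : ((p ∘ ⇑τ.symm) (τ a) : ℕ) + 1 < 3 := by rw [hpa]; exact h
      have hv : (⟨((p ∘ ⇑τ.symm) (τ a) : ℕ) + 1, h'⟩ : Fin 3) = ⟨(p a : ℕ) + 1, h⟩ := Fin.ext (by simp)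
      rw [eval_cover_setInd _ _ _ h', eval_cover_setInd _ _ _ h, setInd_map_compEquivD, setInd_map_compEquivD, hv]
      have e1 : (update p a (⟨(p a : ℕ) + 1, h⟩ : Fin 3)) ∘ ⇑τ.symm = update (p ∘ ⇑τ.symm) (τ a) ⟨(p a : ℕ) + 1, h⟩ := by
        funext b
        by_cases hb : b = τ a
        · rw [hb, update_self, Function.comp_apply, Equiv.symm_apply_apply, update_self]
        · have hb' : τ.symm b ≠ a := fun h2 => hb (by rw [← h2]; simp)
          rw [update_of_ne hb, Function.comp_apply, Function.comp_apply, update_of_ne hb']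
      rw [e1]
    · have h' : ¬ ((p ∘ ⇑τ.symm) (τ a) : ℕ) + 1 < 3 := by rw [hpa]; exact h
      show (if h'' : ((p ∘ ⇑τ.symm) (τ a) : ℕ) + 1 < 3 then _ else (0:ℝ)) = (if h'' : (p a : ℕ) + 1 < 3 then _ else (0:ℝ))
      rw [dif_neg h', dif_neg h]

/-- `sStarD` is invariant under axis permutations (p1's `tcD_perm`), in the form needed here. [this work] -/
theorem sStarD_perm_eq (τ : Equiv.Perm (Fin d)) {A A' : Finset (Pd d)} (h : ∀ p, p ∈ A' ↔ p ∘ ⇑τ ∈ A) (B' C' : Finset (Pd d)) :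
    sStarD A' B' C' = sStarD A (B'.map (compEquivD τ).toEmbedding) (C'.map (compEquivD τ).toEmbedding) := by
  rw [sStarD_eq_sum_tcD, sStarD_eq_sum_tcD]
  let e : Pd d ≃ Pd d := compEquivD τ
  refine Finset.sum_equiv e (fun p => ?_) fun p _ => ?_
  · rw [h p]; rfl
  · refine Finset.sum_equiv e (fun q => ?_) fun q _ => ?_
    · rw [Finset.mem_map_equiv, Equiv.symm_apply_apply]
    · refine Finset.sum_equiv e (fun r => ?_) fun r _ => ?_
      · rw [Finset.mem_map_equiv, Equiv.symm_apply_apply]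
      · exact (tcD_perm τ p q r).symm

/-- **Pinned certificates transport along axis permutations.** [this work] -/
theorem PinnedGood.perm (τ : Equiv.Perm (Fin d)) {A A' : Finset (Pd d)} (hA : PinnedGood d A) (h : ∀ p, p ∈ A' ↔ p ∘ ⇑τ ∈ A) :
    PinnedGood d A' := by
  obtain ⟨ι, hι, c, J, J', hc, hid⟩ := hA
  refine ⟨ι, hι, c, fun i => (J i).perm τ, fun i => (J' i).perm τ, hc, fun B' C' hB' hC' => ?_⟩
  dsimp only
  rw [sStarD_perm_eq τ h]
  have := hid _ _ (isUpperSet_map_compEquivD τ hB') (isUpperSet_map_compEquivD τ hC')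
  dsimp only at this
  rw [this]
  simp only [Lit.eval_perm]

end General

/-! ### Dimension three: prim-sahi-p1's slice certificates ARE pinned certificates -/

section Three

/-- p1's generators (point evaluations and upward differences `[x = hi] − [x = lo]`, `pnt lo ≤ pnt hi`) are cone functionals. [this work] -/
theorem inCone_gcoP (g : ℕ) : InCone 3 (fun B => ((∑ x ∈ B, gcoP g x : ℤ) : ℝ)) := by
  obtain ⟨h1, h2, hle⟩ := genOK_getD g
  by_cases h : (genTab.getD g (0, 0)).1 = (genTab.getD g (0, 0)).2
  · refine (InCone.point (pnt (genTab.getD g (0, 0)).1 : Q 3 3)).congr fun B _ => ?_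
    have e : (∑ x ∈ B, gcoP g x) = ind B (pnt (genTab.getD g (0, 0)).1) := by
      rw [Finset.sum_congr rfl (fun x _ => show gcoP g x = (if pidx x = (genTab.getD g (0, 0)).1 then (1:ℤ) else 0) by
        unfold gcoP; rw [if_pos h])]
      exact sum_ite_pidx B h1
    rw [e, cast_ind]
  · refine (InCone.incr_of_le (lo := (pnt (genTab.getD g (0, 0)).1 : Q 3 3)) (hi := pnt (genTab.getD g (0, 0)).2) fun a => hle a).congr
      fun B _ => ?_
    have e : (∑ x ∈ B, gcoP g x) = ind B (pnt (genTab.getD g (0, 0)).2) - ind B (pnt (genTab.getD g (0, 0)).1) := by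
      rw [Finset.sum_congr rfl (fun x _ => show gcoP g x =
        (if pidx x = (genTab.getD g (0, 0)).2 then (1:ℤ) else 0) - (if pidx x = (genTab.getD g (0, 0)).1 then (1:ℤ) else 0) by
          unfold gcoP; rw [if_neg h]), Finset.sum_sub_distrib, sum_ite_pidx B h2, sum_ite_pidx B h1]
    rw [e]; push_cast; rw [cast_ind, cast_ind]

/-- **A checked slice certificate of prim-sahi-p1 (`sliceCheck`, 226 of them in `…SahiGridPatternSlices1–16`) IS a pinned (pivotal-pair)
certificate of the representative up-set `U v ⊆ [3]^3`.** [this work] -/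
theorem pinnedGood_of_sliceCheck {v : List ℕ} {L : ℕ} {cert : List (ℕ × ℕ × ℕ)} (h : sliceCheck v L cert = true) :
    PinnedGood 3 (U v) := by
  obtain ⟨hL, hid⟩ := sliceCheck_spec h
  have hLpos : (0:ℝ) < L := by exact_mod_cast hL
  -- the certified integer identity  L · sStarD (U v) B C = Σ_e c_e · (Σ_B γ_e) · (Σ_C γ'_e)
  have key : ∀ B C : Finset P3, (L : ℤ) * sStarD (U v) B C =
      (cert.map fun e => (e.1 : ℤ) * ((∑ q ∈ B, gcoP e.2.1 q) * (∑ r ∈ C, gcoP e.2.2 r))).sum := by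
    intro B C
    rw [sStarD_eq_sum_tcP]
    have hswap : ∑ p ∈ U v, ∑ q ∈ B, ∑ r ∈ C, tcP p q r = ∑ q ∈ B, ∑ r ∈ C, betaL v q r := by
      rw [Finset.sum_comm]
      refine Finset.sum_congr rfl fun q _ => ?_
      rw [Finset.sum_comm]
      exact Finset.sum_congr rfl fun r _ => (betaL_eq v q r).symm
    rw [hswap, Finset.mul_sum]
    have h2 : ∑ q ∈ B, (L : ℤ) * ∑ r ∈ C, betaL v q r = ∑ q ∈ B, ∑ r ∈ C, certL cert q r := by
      refine Finset.sum_congr rfl fun q _ => ?_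
      rw [Finset.mul_sum]
      exact Finset.sum_congr rfl fun r _ => hid q r
    rw [h2]
    unfold certL
    rw [sum_sum_listSum]
    exact congrArg List.sum (List.map_congr_left fun e _ => sum_sum_mul B C _ _ _)
  -- each certificate term, divided by L, is in the pair cone
  have hterm : ∀ e ∈ cert, InPairCone 3 (fun B C =>
      (((e.1 : ℤ) * ((∑ q ∈ B, gcoP e.2.1 q) * (∑ r ∈ C, gcoP e.2.2 r)) : ℤ) : ℝ) * (L : ℝ)⁻¹) := by
    intro e _
    refine ((InPairCone.mul (inCone_gcoP e.2.1) (inCone_gcoP e.2.2)).smul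
      (mul_nonneg (Nat.cast_nonneg e.1) (inv_nonneg.2 hLpos.le) : (0:ℝ) ≤ (e.1 : ℝ) * (L : ℝ)⁻¹)).congr fun B C _ _ => ?_
    push_cast; ring
  refine (InPairCone.listSum cert hterm).congr fun B C _ _ => ?_
  rw [List.sum_map_mul_right]
  have hc : (cert.map fun e => ((((e.1 : ℤ) * ((∑ q ∈ B, gcoP e.2.1 q) * (∑ r ∈ C, gcoP e.2.2 r)) : ℤ) : ℝ))).sum =
      (((cert.map fun e => (e.1 : ℤ) * ((∑ q ∈ B, gcoP e.2.1 q) * (∑ r ∈ C, gcoP e.2.2 r))).sum : ℤ) : ℝ) := by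
    rw [Int.cast_list_sum, List.map_map]; rfl
  rw [hc, ← key B C]
  push_cast
  field_simp

/-- **Assembly principle**: pinned certificates for the `226` orbit representatives give pinned certificates for ALL `980` up-sets of `[3]^3`
(p1's cover `exists_cover` / `coverData_check` + `PinnedGood.perm`). [this work] -/
theorem pinnedGood_three_of_reps (hrep : ∀ w ∈ repVecs, PinnedGood 3 (U w)) {A : Finset P3} (hA : IsUpperSet (A : Set P3)) :
    PinnedGood 3 A := by
  obtain ⟨e, he, hUe⟩ := exists_cover hA
  have hw := hrep _ (coverData_rep_mem e he)
  rw [← hUe]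
  exact hw.perm (permList.getD e.2.2 1) fun p => by rw [mem_U_iff, mem_U_iff, coverData_check e he p]

/-- … hence `PinnedLitCert 3 2` (the `(3,3)` row of the pinned format), given the representatives. [this work] -/
theorem pinnedLitCert_three_two_of_reps (hrep : ∀ w ∈ repVecs, PinnedGood 3 (U w)) : PinnedLitCert 3 2 :=
  pinnedLitCert_two_of_forall_pinnedGood fun _ hA => pinnedGood_three_of_reps hrep hA

end Three

end SahiSlot

end Summit.CriticalPhenomena.PercolationContinuityZ3.Theorems
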